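import Mathlib
import Literature.Computability.AlgebraicComplexity.BD17DescartesSystemsWronskians
import Literature.Computability.AlgebraicComplexity.BD17RealExponentDescartesRule
import Literature.Computability.AlgebraicComplexity.BD17GaleRootCount
import HarnessLib

/-!
# GrassmannConvexity

Topic `Literature/Analysis/ODE`. Named literature fact(s) relocated by the gate from `Summits/ValiantsHypothesis/ValiantsHypothesis/Theorems/KPlusLogSqLawWeakLiftingTowerGraftWronskianGrassmannConvexity.lean`
(accept-time relocation of `[cite]`d propositions written inline in a Summits proposal; human ruling 2026-08-15).
Sources: SaldanhaShapiroShapiro2021.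

* `Literature.Analysis.ODE.GrassmannConvexityTwo`
-/

namespace Literature.Analysis.ODE

open Polynomial Finset
open scoped BigOperators Polynomial
open Literature.Computability.AlgebraicComplexity
open Literature.Computability.AlgebraicComplexity.BD17 (linComb rootCountMult SatisfiesDescartesRule)

/-- **The Grassmann convexity theorem for `k = 2` (Saldanha–Shapiro–Shapiro 2021, Theorem 1; the case `n = 4` is Shapiro–Shapiro
2000).**  As printed (Definition 1.1, statement (1.2), Theorem 1): an equation `y⁽ⁿ⁾ + p₁(x)y⁽ⁿ⁻¹⁾ + … + pₙ(x)y = 0` with real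
continuous coefficients on an interval `I` is *disconjugate on `I`* if any of its nontrivial solutions has at most `n − 1` zeros on
`I` counting multiplicities; (1.2) «Given any equation (1.1) disconjugate on `I`, a positive integer `1 ≤ k ≤ n − 1`, and an
arbitrary `k`-tuple `(y₁, …, y_k)` of its linearly independent solutions, the number of real zeros of `det W(y₁, …, y_k)` on `I`
counting multiplicities does not exceed `k(n − k)`»; «THEOREM 1. (1.2) holds for `k = 2` and `k = n − 2` for any `n ≥ 3`.»
Typed here for `k = 2`, in the tree's vocabulary (`BD17.linComb`, `BD17.wronskian`, `BD17.rootCountMult`), as the special case of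
an ANALYTIC fundamental system `f₀, …, f_{n−1}` on an OPEN interval `Δ` with nowhere-vanishing Wronskian `W(f₀, …, f_{n−1})`
(the equation is `W(f₀, …, f_{n−1}, y) / W(f₀, …, f_{n−1}) = 0`, analytic coefficients, solution space `{Σ aᵢfᵢ}`): if every
nontrivial combination `Σ aᵢfᵢ` has finitely many zeros in `Δ`, at most `n − 1` counting multiplicities, then for linearly
independent coefficient vectors `a, b` the Wronskian `y₁y₂′ − y₁′y₂` of `y₁ = Σ aᵢfᵢ`, `y₂ = Σ bᵢfᵢ` has finitely many zeros in
`Δ`, at most `2(n − 2)` counting multiplicities.  PROVED in the cited source (25 pp., total positivity and a rank function on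
admissible cyclic words); not formalised here.
[cite: SaldanhaShapiroShapiro2021, Theorem 1 (with Definition 1.1 and statement (1.2)), pp. 613–614]
[file Analysis/ODE/GrassmannConvexity] -/
def GrassmannConvexityTwo : Prop :=
  ∀ (n : ℕ), 3 ≤ n → ∀ (Δ : Set ℝ), IsOpen Δ → IsConnected Δ →
    ∀ (f : Fin n → ℝ → ℝ), (∀ i, AnalyticOnNhd ℝ (f i) Δ) → (∀ x ∈ Δ, BD17.wronskian f x ≠ 0) →
      (∀ a : Fin n → ℝ, a ≠ 0 →
        {x | x ∈ Δ ∧ linComb a f x = 0}.Finite ∧ rootCountMult (linComb a f) Δ ≤ n - 1) →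
      ∀ (a b : Fin n → ℝ), LinearIndependent ℝ ![a, b] →
        {x | x ∈ Δ ∧ linComb a f x * deriv (linComb b f) x - deriv (linComb a f) x * linComb b f x = 0}.Finite ∧
          rootCountMult (fun x => linComb a f x * deriv (linComb b f) x - deriv (linComb a f) x * linComb b f x) Δ ≤
            2 * (n - 2)
-- TODO(general form): continuous coefficients `pᵢ` on an arbitrary (open or closed) interval and `Cⁿ` solutions; the source
-- proves the same bound `k(n − k)` also for `k = n − 2`.

/-! ## The Wronskian of a system of monomials -/

end Literature.Analysis.ODE
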